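import Literature.AlgebraicGeometry.Motives.MixedHodgeStructureUniserialRadicalSeries
import Literature.AlgebraicGeometry.Motives.MixedHodgeStructureGrWConservative
import Literature.AlgebraicGeometry.Motives.MixedHodgeStructureLoewyLengthWeights
import HarnessLib

/-!
# Uniserial graded-polarizable mixed Hodge structures: the socle series is the weight filtration

Sequel to `MixedHodgeStructureUniserial` / `…UniserialRadicalSeries` (`H.IsUniserial`; Krause's `λ(H) = ℓℓ(H)`;
every sub-MHS of a uniserial `H` is a socle-series term `soc^k H`, unique atom `soc H`, unique coatom `rad H`),
`…LengthFormulas` §3 (`λ(H) = Σ_k λ(Gr^W_k H)`, `#{k | Gr^W_k H ≠ 0} ≤ λ(H)`) and `…LoewyLengthWeights`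
(`ℓℓ(H) ≤ #weights` for graded-polarizable `H`). For a GRADED-POLARIZABLE mixed Hodge structure `H` the graded
pieces `Gr^W_k H` are polarizable pure Hodge structures, hence semisimple, the lowest weight step `W_n H` lies in
the socle and the radical lies in the highest proper weight step (Jannsen, *Mixed Motives and Algebraic K-Theory*,
proof of Thm. 7.9: "every pure polarizable Hodge structure is semisimple"; the tree's
`IsGradedPolarizable.isSemisimple_gr`, `W_le_socle`, `radical_le_W`). Combining this with the module-theoretic
characterisations of uniserial objects (Anderson–Fuller §32, Lemma 32.1; Krause, Lemma 13.1.26) gives the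
following description of the uniserial graded-polarizable MHS — consequences assembled here from the cited results:

* §1 `Gr^W_k` of a uniserial MHS is uniserial; `W_{k-1} H ⋖ W_k H` iff `Gr^W_k H` is simple; for graded-polarizable
  uniserial `H`, **`Gr^W_k H` is SIMPLE for every weight `k`** (`IsUniserial.isSimple_gr`), `λ(Gr^W_k H) = 1` or `0`,
  and `W_{k-1} H ⋖ W_k H` exactly at the weights.
* §2 in general `#weights ≤ λ(H)` (`ncard_isWeight_le_length`) with equality iff every non-zero `Gr^W_k H` is simple
  (`length_eq_ncard_isWeight_iff_forall_isSimple_gr`); with `ℓℓ(H) ≤ #weights` (graded-polarizable) this gives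
  **`IsGradedPolarizable.isUniserial_iff`: `H` is uniserial iff all non-zero `Gr^W_k H` are simple and
  `ℓℓ(H) = #weights`**; for uniserial graded-polarizable `H`: `λ(H) = ℓℓ(H) = #weights`.
* §3 **the weight filtration of a uniserial graded-polarizable `H` IS its socle (= unique composition) series**:
  `λ(W_k H) = #{weights ≤ k}` and `W_k H = soc^{#{weights ≤ k}} H` (`IsUniserial.weight_eq_socleSeries`); the socle is
  the lowest weight step and the radical is the highest proper one (`IsUniserial.socle_eq_weight`,
  `IsUniserial.radical_eq_weight`); conversely EVERY sub-MHS is some `W_k H` (`IsUniserial.exists_eq_weight`), so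
  **a graded-polarizable MHS is uniserial iff its sub-MHS are exactly the weight steps**
  (`IsGradedPolarizable.isUniserial_iff_forall_exists_eq_weight`) and it then has `#weights + 1` sub-MHS;
  a `ℚ`-split uniserial graded-polarizable MHS is simple or zero.

All statements proved; no definitions, no named facts, no instances.

## References

* [Jannsen1990MixedMotives] U. Jannsen, Mixed Motives and Algebraic K-Theory, LNM 1400 (1990), Thm. 7.9 (proof).
* [AndersonFuller1992] F. W. Anderson, K. R. Fuller, Rings and Categories of Modules, 2nd ed. (1992), §32, Lemma 32.1.
* [Krause2021] H. Krause, Homological Theory of Representations (2021), Lemma 13.1.26.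
* [CattaniElZeinGriffithsLe2014] E. Cattani et al. (eds.), Hodge Theory (2014), Def. 3.2.15, Thm. 3.2.18, p. 270,
  Ch. 12 footnote 2 (p. 527).
-/

noncomputable section

namespace Literature.AlgebraicGeometry.Motives

namespace MixedHodgeStructure

universe u

variable {V : Type u} [AddCommGroup V] [Module ℚ V] {H : MixedHodgeStructure V}

open SubMixedHodgeStructure

/-! ### §1 The graded pieces of a uniserial mixed Hodge structure -/

/-- **`Gr^W_k H` of a uniserial `H` is uniserial** (`Gr^W_k H = W_k H / W_{k-1} H` is a subquotient).
[cite: AndersonFuller1992, §32, Lemma 32.1] [cite: CattaniElZeinGriffithsLe2014, Def. 3.2.15] -/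
theorem IsUniserial.gr (hu : H.IsUniserial) (k : ℤ) : (H.gr k).toMixedHodgeStructure.IsUniserial := by
  rw [gr_toMixedHodgeStructure_eq_quotient]
  exact (hu.subMixedHodgeStructure (weight H k)).quotient (weightPred H k)

/-- `λ(Gr^W_k H) > 0` iff `k` is a weight of `H`. [cite: CattaniElZeinGriffithsLe2014, Def. 3.2.15] [cite: Beachy1999RingsModules, §2.5, Def. 2.5.3] -/
theorem length_gr_pos_iff [FiniteDimensional ℚ V] (H : MixedHodgeStructure V) (k : ℤ) :
    0 < (H.gr k).toMixedHodgeStructure.length ↔ H.IsWeight k := by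
  rw [length_pos_iff, ← not_iff_not, not_nontrivial_iff_subsingleton, subsingleton_grW_iff_not_isWeight]

/-- `λ(Gr^W_k H) = 0` iff `k` is not a weight of `H`. [cite: CattaniElZeinGriffithsLe2014, Def. 3.2.15] [cite: Beachy1999RingsModules, §2.5, Def. 2.5.3] -/
theorem length_gr_eq_zero_iff [FiniteDimensional ℚ V] (H : MixedHodgeStructure V) (k : ℤ) :
    (H.gr k).toMixedHodgeStructure.length = 0 ↔ ¬H.IsWeight k := by
  rw [length_eq_zero_iff, subsingleton_grW_iff_not_isWeight]

/-- **`W_{k-1} H ⋖ W_k H` in the lattice of sub-MHS iff `Gr^W_k H = W_k H ∕ W_{k-1} H` is simple.**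
[cite: CattaniElZeinGriffithsLe2014, Def. 3.2.15, Lemma 3.2.20 and p. 270] [cite: Beachy1999RingsModules, §2.5, Def. 2.5.1] -/
theorem toElt_weight_pred_covBy_iff (H : MixedHodgeStructure V) (k : ℤ) :
    (weight H (k - 1)).toElt ⋖ (weight H k).toElt ↔ (H.gr k).toMixedHodgeStructure.IsSimple := by
  rw [gr_toMixedHodgeStructure_eq_quotient]
  exact toElt_covBy_toElt_iff (weight_mono H (by omega))

/-- **For a uniserial graded-polarizable `H`, `Gr^W_k H` is simple for every weight `k`** (it is semisimple —
a polarizable pure Hodge structure —, uniserial and non-zero). [cite: Jannsen1990MixedMotives, Thm. 7.9 (proof)]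
[cite: AndersonFuller1992, §32, Lemma 32.1 (proof of (a) ⟹ (c), (d))] -/
theorem IsUniserial.isSimple_gr [FiniteDimensional ℚ V] (hu : H.IsUniserial) (hp : H.IsGradedPolarizable) {k : ℤ}
    (hk : H.IsWeight k) : (H.gr k).toMixedHodgeStructure.IsSimple := by
  haveI : Nontrivial (grW H.W k) := by
    rw [← not_subsingleton_iff_nontrivial, subsingleton_grW_iff_not_isWeight, not_not]
    exact hk
  exact (hu.gr k).isSimple_of_isSemisimple (hp.isSemisimple_gr k)

open scoped Classical in
/-- For a uniserial graded-polarizable `H`: `λ(Gr^W_k H) = 1` for weights `k`, `0` otherwise.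
[cite: Jannsen1990MixedMotives, Thm. 7.9 (proof)] [cite: Beachy1999RingsModules, §2.5, Def. 2.5.3] -/
theorem IsUniserial.length_gr [FiniteDimensional ℚ V] (hu : H.IsUniserial) (hp : H.IsGradedPolarizable) (k : ℤ) :
    (H.gr k).toMixedHodgeStructure.length = if H.IsWeight k then 1 else 0 := by
  split_ifs with hk
  · exact length_eq_one_iff.2 (hu.isSimple_gr hp hk)
  · exact (length_gr_eq_zero_iff H k).2 hk

/-- For a uniserial graded-polarizable `H`: **`W_{k-1} H ⋖ W_k H` iff `k` is a weight.**
[cite: Jannsen1990MixedMotives, Thm. 7.9 (proof)] [cite: CattaniElZeinGriffithsLe2014, Def. 3.2.15 and Lemma 3.2.20] -/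
theorem IsUniserial.toElt_weight_pred_covBy_iff [FiniteDimensional ℚ V] (hu : H.IsUniserial) (hp : H.IsGradedPolarizable)
    (k : ℤ) : (weight H (k - 1)).toElt ⋖ (weight H k).toElt ↔ H.IsWeight k :=
  ⟨fun h => toElt_lt_toElt_iff.1 h.lt, fun hk =>
    (MixedHodgeStructure.toElt_weight_pred_covBy_iff H k).2 (hu.isSimple_gr hp hk)⟩

/-! ### §2 `ℓℓ(H) ≤ #weights ≤ λ(H)`; uniserial ⟺ both are equalities -/

/-- **`#{weights of H} ≤ λ(H)`**: each non-zero graded piece contributes at least one composition factor.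
[cite: Beachy1999RingsModules, §2.5, Def. 2.5.3] [cite: CattaniElZeinGriffithsLe2014, Def. 3.2.15 and Thm. 3.2.18] -/
theorem ncard_isWeight_le_length [FiniteDimensional ℚ V] (H : MixedHodgeStructure V) :
    {k | H.IsWeight k}.ncard ≤ H.length := by
  have e : {k | H.IsWeight k} = Function.support fun k => (H.gr k).toMixedHodgeStructure.length := by
    ext k
    rw [Set.mem_setOf_eq, Function.mem_support, ← Nat.pos_iff_ne_zero, length_gr_pos_iff]
  rw [e]
  exact card_support_gr_le_length H

/-- **`λ(H) = #weights` iff `λ(Gr^W_k H) = 1` for every weight `k`** (the terms `λ(Gr^W_k H) ≥ 1` of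
`λ(H) = Σ_k λ(Gr^W_k H)` over the weights must all be `1`). [cite: Beachy1999RingsModules, §2.5, Def. 2.5.3]
[cite: CattaniElZeinGriffithsLe2014, Def. 3.2.15 and Thm. 3.2.18] -/
theorem length_eq_ncard_isWeight_iff [FiniteDimensional ℚ V] (H : MixedHodgeStructure V) :
    H.length = {k | H.IsWeight k}.ncard ↔ ∀ k, H.IsWeight k → (H.gr k).toMixedHodgeStructure.length = 1 := by
  classical
  obtain ⟨a, ha⟩ := H.exists_W_eq_bot
  obtain ⟨b, hb⟩ := H.exists_W_eq_top
  have hsub : ∀ k, H.IsWeight k → k ∈ Finset.Ioc a b := fun k hk => by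
    have h := IsWeight.mem_Icc (a := a + 1) (by rw [add_sub_cancel_right]; exact ha) hb hk
    rw [Finset.mem_Icc] at h
    rw [Finset.mem_Ioc]
    omega
  have hncard : {k | H.IsWeight k}.ncard = ((Finset.Ioc a b).filter H.IsWeight).card := by
    rw [← Set.ncard_coe_finset]
    congr 1
    ext k
    rw [Set.mem_setOf_eq, Finset.coe_filter, Set.mem_setOf_eq]
    exact ⟨fun hk => ⟨hsub k hk, hk⟩, fun hk => hk.2⟩
  rw [length_eq_sum_length_gr H ha hb, hncard, Finset.card_filter]
  have hle : ∀ i ∈ Finset.Ioc a b, (if H.IsWeight i then 1 else 0) ≤ (H.gr i).toMixedHodgeStructure.length :=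
    fun i _ => by
      split_ifs with hi
      · exact (length_gr_pos_iff H i).2 hi
      · exact Nat.zero_le _
  constructor
  · intro h k hk
    have hk' := (Finset.sum_eq_sum_iff_of_le hle).1 h.symm k (hsub k hk)
    rw [if_pos hk] at hk'
    exact hk'.symm
  · intro h
    refine Finset.sum_congr rfl fun k _ => ?_
    split_ifs with hk
    · exact h k hk
    · exact (length_gr_eq_zero_iff H k).2 hk

/-- **`λ(H) = #weights` iff `Gr^W_k H` is simple for every weight `k`.** [cite: Beachy1999RingsModules, §2.5, Def. 2.5.3]
[cite: CattaniElZeinGriffithsLe2014, Def. 3.2.15 and p. 270] -/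
theorem length_eq_ncard_isWeight_iff_forall_isSimple_gr [FiniteDimensional ℚ V] (H : MixedHodgeStructure V) :
    H.length = {k | H.IsWeight k}.ncard ↔ ∀ k, H.IsWeight k → (H.gr k).toMixedHodgeStructure.IsSimple := by
  rw [length_eq_ncard_isWeight_iff]
  exact forall₂_congr fun k _ => length_eq_one_iff

/-- **A graded-polarizable `H` is uniserial iff every non-zero `Gr^W_k H` is simple and `ℓℓ(H) = #weights`**
(from `ℓℓ(H) ≤ #weights ≤ λ(H)` and Krause's criterion `λ(H) = ℓℓ(H)`). [cite: Krause2021, Lemma 13.1.26]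
[cite: Jannsen1990MixedMotives, Thm. 7.9 (proof)] [cite: AndersonFuller1992, §32, Lemma 32.1] -/
theorem IsGradedPolarizable.isUniserial_iff [FiniteDimensional ℚ V] (hp : H.IsGradedPolarizable) :
    H.IsUniserial ↔ (∀ k, H.IsWeight k → (H.gr k).toMixedHodgeStructure.IsSimple) ∧
      loewyLength H = {k | H.IsWeight k}.ncard := by
  rw [isUniserial_iff_length_eq_loewyLength, ← length_eq_ncard_isWeight_iff_forall_isSimple_gr]
  have h₁ := hp.loewyLength_le_ncard_isWeight
  have h₂ := ncard_isWeight_le_length H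
  constructor
  · intro h
    exact ⟨by omega, by omega⟩
  · rintro ⟨h₃, h₄⟩
    omega

/-- **`λ(H) = #weights`** for a uniserial graded-polarizable `H`. [cite: Krause2021, Lemma 13.1.26] [cite: Jannsen1990MixedMotives, Thm. 7.9 (proof)] -/
theorem IsUniserial.length_eq_ncard_isWeight [FiniteDimensional ℚ V] (hu : H.IsUniserial) (hp : H.IsGradedPolarizable) :
    H.length = {k | H.IsWeight k}.ncard :=
  (length_eq_ncard_isWeight_iff_forall_isSimple_gr H).2 ((hp.isUniserial_iff.1 hu).1)

/-- **`ℓℓ(H) = #weights`** for a uniserial graded-polarizable `H` (the bound `ℓℓ(H) ≤ #weights` is attained).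
[cite: Krause2021, Lemma 13.1.26] [cite: Jannsen1990MixedMotives, Thm. 7.9 (proof)] -/
theorem IsUniserial.loewyLength_eq_ncard_isWeight [FiniteDimensional ℚ V] (hu : H.IsUniserial) (hp : H.IsGradedPolarizable) :
    loewyLength H = {k | H.IsWeight k}.ncard :=
  (hp.isUniserial_iff.1 hu).2

/-- A graded-polarizable `H` with `ℓℓ(H) < #weights` (e.g. a non-trivially split one) is not uniserial.
[cite: Krause2021, Lemma 13.1.26] [cite: Jannsen1990MixedMotives, Thm. 7.9 (proof)] -/
theorem IsGradedPolarizable.not_isUniserial_of_loewyLength_lt [FiniteDimensional ℚ V] (hp : H.IsGradedPolarizable)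
    (h : loewyLength H < {k | H.IsWeight k}.ncard) : ¬H.IsUniserial :=
  fun hu => (hu.loewyLength_eq_ncard_isWeight hp).not_lt h

/-- **A `ℚ`-split uniserial graded-polarizable MHS on a non-zero space is simple** (it is semisimple).
[cite: CattaniElZeinGriffithsLe2014, Ch. 12 footnote 2 (p. 527)] [cite: AndersonFuller1992, §32, Lemma 32.1] -/
theorem IsUniserial.isSimple_of_isSplitOverQ [FiniteDimensional ℚ V] [Nontrivial V] (hu : H.IsUniserial)
    (hp : H.IsGradedPolarizable) (hs : H.IsSplitOverQ) : H.IsSimple :=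
  hu.isSimple_of_isSemisimple (hs.isSemisimple hp)

/-- Hence a uniserial graded-polarizable MHS with at least two weights is not `ℚ`-split.
[cite: CattaniElZeinGriffithsLe2014, Ch. 12 footnote 2 (p. 527)] [cite: Jannsen1990MixedMotives, Thm. 7.9 (proof)] -/
theorem IsUniserial.not_isSplitOverQ_of_two_le [FiniteDimensional ℚ V] (hu : H.IsUniserial) (hp : H.IsGradedPolarizable)
    (h2 : 2 ≤ {k | H.IsWeight k}.ncard) : ¬H.IsSplitOverQ := fun hs => by
  rcases subsingleton_or_nontrivial V with hV | hV
  · rw [← hu.length_eq_ncard_isWeight hp, length_eq_zero_iff.2 hV] at h2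
    omega
  · rw [← hu.length_eq_ncard_isWeight hp, length_eq_one_iff.2 (hu.isSimple_of_isSplitOverQ hp hs)] at h2
    omega

/-! ### §3 The weight filtration of a uniserial graded-polarizable MHS is its socle series -/

open scoped Classical in
/-- **`λ(W_k H) = #{weights j ≤ k}`** for a uniserial graded-polarizable `H`. [cite: Beachy1999RingsModules, §2.5, Def. 2.5.3]
[cite: Jannsen1990MixedMotives, Thm. 7.9 (proof)] [cite: CattaniElZeinGriffithsLe2014, Def. 3.2.15] -/
theorem IsUniserial.length_weight [FiniteDimensional ℚ V] (hu : H.IsUniserial) (hp : H.IsGradedPolarizable) (k : ℤ) :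
    (weight H k).toMixedHodgeStructure.length = {j | H.IsWeight j ∧ j ≤ k}.ncard := by
  obtain ⟨a, ha⟩ := H.exists_W_eq_bot
  rcases le_or_gt a k with hak | hka
  · obtain ⟨n, rfl⟩ := Int.le.dest hak
    rw [length_weight_add_eq, length_weight_of_W_eq_bot H ha, zero_add,
      Finset.sum_congr rfl fun j _ => hu.length_gr hp j, ← Finset.card_filter, ← Set.ncard_coe_finset]
    congr 1
    ext j
    rw [Finset.coe_filter, Set.mem_setOf_eq, Set.mem_setOf_eq, Finset.mem_Ioc]
    constructor
    · rintro ⟨⟨-, h₂⟩, h₃⟩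
      exact ⟨h₃, h₂⟩
    · rintro ⟨h₃, h₂⟩
      exact ⟨⟨lt_of_not_ge fun h => not_isWeight_of_W_eq_bot ha h h₃, h₂⟩, h₃⟩
  · -- below the weight range: `W_k H = 0` and there is no weight `≤ k`
    have hk : H.W k = ⊥ := eq_bot_iff.2 (ha ▸ H.monotone_W hka.le)
    have hempty : {j | H.IsWeight j ∧ j ≤ k} = ∅ :=
      Set.eq_empty_iff_forall_notMem.2 fun j hj => not_isWeight_of_W_eq_bot hk hj.2 hj.1
    rw [length_weight_of_W_eq_bot H hk, hempty, Set.ncard_empty]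

/-- **The weight filtration is the socle series: `W_k H = soc^{#{weights ≤ k}} H`** for a uniserial
graded-polarizable `H` (every sub-MHS of a uniserial `H` is the socle-series term indexed by its length).
[cite: AndersonFuller1992, §32, Lemma 32.1 ((b), (d))] [cite: Jannsen1990MixedMotives, Thm. 7.9 (proof)]
[cite: CattaniElZeinGriffithsLe2014, Def. 3.2.15] -/
theorem IsUniserial.weight_eq_socleSeries [FiniteDimensional ℚ V] (hu : H.IsUniserial) (hp : H.IsGradedPolarizable) (k : ℤ) :
    weight H k = socleSeries H {j | H.IsWeight j ∧ j ≤ k}.ncard := by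
  rw [← hu.length_weight hp k]
  exact hu.eq_socleSeries_length (weight H k)

/-- … and also a radical-series term: `W_k H = rad^{ℓℓ(H) − #{weights ≤ k}} H`. [cite: AndersonFuller1992, §32, Lemma 32.1 ((b), (c))]
[cite: Jannsen1990MixedMotives, Thm. 7.9 (proof)] -/
theorem IsUniserial.weight_eq_radicalSeries [FiniteDimensional ℚ V] (hu : H.IsUniserial) (hp : H.IsGradedPolarizable) (k : ℤ) :
    weight H k = radicalSeries H (loewyLength H - {j | H.IsWeight j ∧ j ≤ k}.ncard) := by
  rw [hu.weight_eq_socleSeries hp k, hu.socleSeries_eq_radicalSeries]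
  rw [← hu.length_eq_loewyLength, ← hu.length_weight hp k]
  exact (weight H k).length_toMixedHodgeStructure_le

/-- **The socle of a uniserial graded-polarizable `H` is its lowest weight step**: `soc H = W_n H` if
`W_{n-1} H = 0` and `n` is a weight. [cite: Jannsen1990MixedMotives, Thm. 7.9 (proof)] [cite: AndersonFuller1992, §32, Lemma 32.1 (d)] -/
theorem IsUniserial.socle_eq_weight [FiniteDimensional ℚ V] (hu : H.IsUniserial) (hp : H.IsGradedPolarizable) {n : ℤ}
    (hn : H.W (n - 1) = ⊥) (hw : H.IsWeight n) : socle H = weight H n := by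
  refine (hu.eq_socle_of_isSimple (weight H n) ?_).symm
  have hlt : (⊥ : Submodule ℚ V) < H.W n := by
    have h := hw
    rwa [IsWeight, hn] at h
  haveI : Nontrivial (weight H n).toSubmodule := Submodule.nontrivial_iff_ne_bot.2 hlt.ne'
  exact (hu.subMixedHodgeStructure _).isSimple_of_isSemisimple (hp.isSemisimple_weight hn)

/-- **The radical of a uniserial graded-polarizable `H` is its highest proper weight step**: `rad H = W_{b-1} H`
if `W_b H = H` and `b` is a weight. [cite: Jannsen1990MixedMotives, Thm. 7.9 (proof)] [cite: AndersonFuller1992, §32, Lemma 32.1 (c)] -/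
theorem IsUniserial.radical_eq_weight [FiniteDimensional ℚ V] (hu : H.IsUniserial) (hp : H.IsGradedPolarizable) {b : ℤ}
    (hb : H.W b = ⊤) (hw : H.IsWeight b) : radical H = weight H (b - 1) := by
  refine (hu.eq_radical_of_isSimple_quotient (weight H (b - 1)) ?_).symm
  have hlt : H.W (b - 1) < ⊤ := by
    have h := hw
    rwa [IsWeight, hb] at h
  haveI : Nontrivial (V ⧸ (weight H (b - 1)).toSubmodule) := Submodule.Quotient.nontrivial_iff.2 hlt.ne
  exact (hu.quotient _).isSimple_of_isSemisimple (hp.isSemisimple_weight_quotient hb)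

/-- For a uniserial graded-polarizable `H` with lowest weight `n`: `soc H = W_n H` is simple and isomorphic to
`Gr^W_n H`; in particular `[H : soc H] ≥ 1`. Here: the lowest weight step is a simple sub-MHS.
[cite: Jannsen1990MixedMotives, Thm. 7.9 (proof)] [cite: CattaniElZeinGriffithsLe2014, p. 270] -/
theorem IsUniserial.isSimple_weight_of_W_pred_eq_bot [FiniteDimensional ℚ V] (hu : H.IsUniserial)
    (hp : H.IsGradedPolarizable) {n : ℤ} (hn : H.W (n - 1) = ⊥) (hw : H.IsWeight n) :
    (weight H n).toMixedHodgeStructure.IsSimple := by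
  haveI : Nontrivial V := by
    have hlt : (⊥ : Submodule ℚ V) < H.W n := by
      have h := hw
      rwa [IsWeight, hn] at h
    exact (Submodule.nontrivial_iff (R := ℚ)).1 ⟨⟨⊥, H.W n, hlt.ne⟩⟩
  rw [← hu.socle_eq_weight hp hn hw]
  exact hu.isSimple_socle

/-- **Conversely, every sub-MHS of a uniserial graded-polarizable `H` is a step `W_k H` of the weight filtration**
(discrete intermediate-value argument on `k ↦ W_k H`: for the largest `k ≤ b` (`W_b H = H`) with `W_k H ⊆ L`, if
`W_k H ≠ L` then `W_k H ⊊ L ⊊ W_{k+1} H` by uniseriality, contradicting `W_k H ⋖ W_{k+1} H`). So the sub-MHS of `H`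
are exactly the `W_k H`. [cite: AndersonFuller1992, §32, Lemma 32.1 ((b), (d))] [cite: Jannsen1990MixedMotives, Thm. 7.9 (proof)]
[cite: CattaniElZeinGriffithsLe2014, Def. 3.2.15] -/
theorem IsUniserial.exists_eq_weight [FiniteDimensional ℚ V] (hu : H.IsUniserial) (hp : H.IsGradedPolarizable)
    (L : SubMixedHodgeStructure H) : ∃ k, L = weight H k := by
  obtain ⟨a, ha⟩ := H.exists_W_eq_bot
  obtain ⟨b, hb⟩ := H.exists_W_eq_top
  obtain ⟨k₀, ⟨hk₀L, hk₀b⟩, hmax⟩ :=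
    Int.exists_greatest_of_bdd (P := fun k => H.W k ≤ L.toSubmodule ∧ k ≤ b) ⟨b, fun z hz => hz.2⟩
      ⟨min a b, (H.monotone_W (min_le_left a b)).trans (by rw [ha]; exact bot_le), min_le_right a b⟩
  refine ⟨k₀, ?_⟩
  by_contra hne
  have hlt : H.W k₀ < L.toSubmodule := lt_of_le_of_ne hk₀L fun h => hne (SubMixedHodgeStructure.ext h.symm)
  have hk₀b' : k₀ < b := lt_of_le_of_ne hk₀b (by rintro rfl; rw [hb] at hlt; exact not_top_lt hlt)
  have hnot : ¬H.W (k₀ + 1) ≤ L.toSubmodule := fun h => by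
    have h' := hmax (k₀ + 1) ⟨h, by omega⟩
    omega
  have hlt' : L.toSubmodule < H.W (k₀ + 1) :=
    lt_of_le_of_ne ((hu (weight H (k₀ + 1)) L).resolve_left hnot) fun h => hnot h.symm.le
  have hw : H.IsWeight (k₀ + 1) := by
    show H.W (k₀ + 1 - 1) < H.W (k₀ + 1)
    rw [add_sub_cancel_right]
    exact hlt.trans hlt'
  have hcov := (hu.toElt_weight_pred_covBy_iff hp (k₀ + 1)).2 hw
  rw [add_sub_cancel_right] at hcov
  exact hcov.2 (toElt_lt_toElt_iff.2 hlt) (toElt_lt_toElt_iff.2 hlt')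

/-- Every socle-series term of a uniserial graded-polarizable `H` is a weight step.
[cite: AndersonFuller1992, §32, Lemma 32.1 (d)] [cite: Jannsen1990MixedMotives, Thm. 7.9 (proof)] -/
theorem IsUniserial.exists_socleSeries_eq_weight [FiniteDimensional ℚ V] (hu : H.IsUniserial) (hp : H.IsGradedPolarizable)
    (m : ℕ) : ∃ k, socleSeries H m = weight H k :=
  hu.exists_eq_weight hp _

/-- Every radical-series term of a uniserial graded-polarizable `H` is a weight step.
[cite: AndersonFuller1992, §32, Lemma 32.1 (c)] [cite: Jannsen1990MixedMotives, Thm. 7.9 (proof)] -/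
theorem IsUniserial.exists_radicalSeries_eq_weight [FiniteDimensional ℚ V] (hu : H.IsUniserial) (hp : H.IsGradedPolarizable)
    (m : ℕ) : ∃ k, radicalSeries H m = weight H k :=
  hu.exists_eq_weight hp _

/-- If every sub-MHS of `H` is a weight step `W_k H`, then `H` is uniserial (the `W_k H` form a chain).
[cite: AndersonFuller1992, §32, Lemma 32.1] [cite: CattaniElZeinGriffithsLe2014, Def. 3.2.15] -/
theorem isUniserial_of_forall_exists_eq_weight (h : ∀ L : SubMixedHodgeStructure H, ∃ k, L = weight H k) :
    H.IsUniserial := fun S T => by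
  obtain ⟨j, rfl⟩ := h S
  obtain ⟨k, rfl⟩ := h T
  rcases le_total j k with hjk | hkj
  · exact Or.inl (weight_mono H hjk)
  · exact Or.inr (weight_mono H hkj)

/-- **A graded-polarizable MHS is uniserial iff its sub-MHS are exactly the steps `W_k H` of its weight
filtration.** [cite: AndersonFuller1992, §32, Lemma 32.1] [cite: Jannsen1990MixedMotives, Thm. 7.9 (proof)]
[cite: CattaniElZeinGriffithsLe2014, Def. 3.2.15] -/
theorem IsGradedPolarizable.isUniserial_iff_forall_exists_eq_weight [FiniteDimensional ℚ V] (hp : H.IsGradedPolarizable) :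
    H.IsUniserial ↔ ∀ L : SubMixedHodgeStructure H, ∃ k, L = weight H k :=
  ⟨fun hu => hu.exists_eq_weight hp, isUniserial_of_forall_exists_eq_weight⟩

/-- A uniserial graded-polarizable `H` has exactly `#weights + 1` sub-MHS (namely `0` and the `W_k H`, `k` a weight).
[cite: AndersonFuller1992, §32, Lemma 32.1 (d)] [cite: Krause2021, Lemma 13.1.26] -/
theorem IsUniserial.natCard_subMixedHodgeStructure_eq [FiniteDimensional ℚ V] (hu : H.IsUniserial) (hp : H.IsGradedPolarizable) :
    Nat.card (SubMixedHodgeStructure H) = {k | H.IsWeight k}.ncard + 1 := by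
  rw [hu.natCard_subMixedHodgeStructure, hu.loewyLength_eq_ncard_isWeight hp]

end MixedHodgeStructure

end Literature.AlgebraicGeometry.Motives
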